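import Summits.BirchSwinnertonDyer.BirchSwinnertonDyer.Theorems.ClassRecordThreeCartanCoverJacquetDict
import Summits.BirchSwinnertonDyer.BirchSwinnertonDyer.Theorems.ClassRecordThreeCartanOnePlaceDegreeLawAtThreeCMRankPrintInputsThree
import Summits.BirchSwinnertonDyer.BirchSwinnertonDyer.Theorems.ClassRecordThreeEulerHalvesAtThreeCartanCoverInertHecke
import Summits.BirchSwinnertonDyer.BirchSwinnertonDyer.Theorems.ClassRecordThreeEulerHalvesAtThreeCartanCoverPeriodLattice
import Summits.BirchSwinnertonDyer.BirchSwinnertonDyer.Theorems.ClassRecordThreeEulerHalvesAtThreeCartanCoverStrongApprox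
import Literature.NumberTheory.Automorphic.QuaternionOrderResidueStrongApproximation
import HarnessLib

/-!
# Crux NUM `CartanOnePlaceDegreeLawAtThree` (stmt-BirchSwinnertonDyer-24801), line `jacquet`, stub `stub_jacquetVectorResidual` — STUB-PLAN P0:
# the GLUE (JVᴸ) ⟹ (JV_Q), tree-side, with the print-shaped input (JVᴸ) as a STATEMENT CARRIER (nothing asserted)

Seat `bsd-stepL-tam3-p1` g44 (lineage of record on crux 24801; `--supports stmt-BirchSwinnertonDyer-24801 --as helper`; SUMMON key `jv7dict` (k2) «AMENDED per
director-bsd (910)(a)»: the statement carrier lives HERE, Theorems-side — it is NOT a Literature named fact, its placement (print-as-typed vs composition) is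
pending (910)(a)(β), and it mints no debt). Continues `…ClassRecordThreeCartanCoverJacquetDict` (D-EV `CoverReduction.map_coeEvOne_spanG_dockNonsplit`,
D-AVG `CoverReduction.exists_unipFixed_of_slashFixed`).
* `CartanCoverUnipotentFixedInSpan` — (JVᴸ), body TOKEN FOR TOKEN the body of `ScritSketch.cartanCover_unipotentFixed_in_span` of the stub-critic's
  `Cruxes/CartanOnePlaceDegreeLawAtThree/ScritStubJacquetVectorResidualFact.lean` (eec24659821cf8e5): over EXISTING Literature objects only (`CartanLevelCurveData`,
  `normOneUnits`, a residue model `red` of the cover order `X.O + (∏_{C∖q} p)·X.O₀` in the idiom of `exists_reducedNorm_eq_one_map_eq_of_det_eq_one`), for an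
  `a_ℓ(V)`-eigenform `F₀ ≠ 0` on `X.Gamma` at a Cartan place `q ≡ 1 (3)` with `3 ∣ c_q(V)`: the span of the slashes `F₀ ∣[2] γ` (`γ ∈ ι(O'¹)`) contains a non-zero
  function fixed by every `γ` of upper-unipotent residue. In print: JL + local–global compatibility at `q` (`π_{V,q}` = tame principal series `PS(μ₁ε₃, μ₂ε₃⁻¹)`,
  `e = 3 ∣ q − 1`) + the `K(q)`-type `Ind_B^G(ε̄₃ ⊠ ε̄₃⁻¹)` has `N(𝔽_q)`-fixed vectors + strong approximation. A `def … : Prop`; NOTHING ASSERTED.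
* `JacquetVectorDockedT` — VERBATIM copy (token for token) of the registry's (JV_Q) `Jacquet.JacquetVectorDocked` (`Cruxes/…/Lines/jacquet.lean` rev 11
  94a3f00c0fcfe0c7 l.1310–1319; the registry file is not importable from `Theorems/`, the pen's rev 12 bridges the two by `Iff.rfl`).
* `jacquetVectorDocked_of_unipotentFixed : CartanCoverUnipotentFixedInSpan → JacquetVectorDockedT` — PROVED (the stub-critic's recipe, Dict l.86–89): instantiate
  (JVᴸ) at `hO' := isOrder_coverOrder X q`, `S := coverSubring X q`, `red := R.red` (`R.red_surjective`, `R.red_eq_zero_iff`, `R.det_red`), `F₀ := Q.form`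
  (non-zero by `CartanCover.MapDegree.cartan_form_ne_zero`; `a_ℓ(V)`-eigenvalues by `LFunction_eq_of_isIsogenous_holds` + `Q.hecke_eq`, as in
  `borelCubicEigenDocking_of_jacquet`); read `redHom γ = n(y)` as the three residue entries (`coe_redHom`, `coe_upperUnip`) of `unitLift γ` (`ι_unitLift`);
  then D-AVG (`q ≠ 2` from `q ≡ 1 (3)`).
CONDITIONAL on (JVᴸ) (an explicit hypothesis; no named fact is taken silently). `stub_jacquetVectorResidual` stays a `sorry` in the registry until the pen's
rev 12; counts unmoved; nothing about (JV₇), NUM, 24801 or 19109 is proved for any curve; BSD is proved for no curve.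
[cite: Bump1997, Thm. 4.1.1 p. 406] [cite: Carayol1986, Thm. (A)] [cite: KohenPacetti2016, §1.3 and §2 (arXiv:1403.7801v3 pp. 5–8)]
[cite: VignerasLNM800, Ch. III §4 Thm. 4.3 and §5 Cor. 5.7] [cite: DokchitserDokchitser2010, §3 Case 4c p. 14]
-/

set_option linter.dupNamespace false  -- `Summit.BirchSwinnertonDyer.BirchSwinnertonDyer.…` (summit = problem), as every file of this directory
set_option autoImplicit false

noncomputable section

open scoped Classical Pointwise MatrixGroups ModularForm

namespace Summit.BirchSwinnertonDyer.BirchSwinnertonDyer.Theorems.CartanCover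

open Literature.NumberTheory.Automorphic WeierstrassCurve Literature.NumberTheory.EllipticCurves
open Literature.NumberTheory.EllipticCurves.Rank1Residual (Surj)
open Summit.BirchSwinnertonDyer.BirchSwinnertonDyer.Theorems.CartanCover.Charext.InertHecke (upperUnip coe_upperUnip)

/-! ## §1 The statement carrier (JVᴸ) — NOTHING ASSERTED, NOT a Literature named fact -/

/-- **(JVᴸ) UNIPOTENT-FIXED VECTOR IN THE COVER SPAN OF A CARTAN-LEVEL EIGENFORM AT A TAME CUBIC PLACE** — candidate print-shaped input of STUB-PLAN P0
(stub-critic `scrit-stub_jacquetVectorResidual`, 17386d138746753d); STATEMENT CARRIER, NOTHING ASSERTED; NOT a Literature named fact — director-bsd (910)(a)(β):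
placement pending (print-as-typed vs composition). Body token for token the stub-critic's `ScritSketch.cartanCover_unipotentFixed_in_span` (Fact file eec24659821cf8e5).
For a Cartan datum `X`, `q ∈ C` with `q ≡ 1 (3)`, an elliptic `V/ℚ` of conductor `N = D·M·∏_{p∈C} p²` with `q³ ∤ N` and `3 ∣ c_q(V)`, a non-zero
`a_ℓ(V)`-eigenform `F₀ ∈ S₂(X.Γ)` (good `ℓ`), the cover order `O' = X.O + (∏_{C∖q} p)·X.O₀` (maximal at `q`) with norm-one group `Γ' = ι(O'¹)`, and ANY
residue model `red : O' → M₂(𝔽_q)` (surjective, kernel `qO'`, `det ∘ red = nrd mod q`): the `ℂ`-span of the slashes `F₀ ∣[2] γ`, `γ ∈ Γ'`, contains a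
NON-ZERO function fixed by every `γ ∈ Γ'` whose residue is upper unipotent. Print chain: JL (`π'_q ≅ π_{V,q}`, `q ∤ D`), local–global compatibility at
`q` for `V` (principal series `PS(μ₁ε₃, μ₂ε₃⁻¹)`), `K(q)`-type of a tame principal series `= Ind_B^G(ε̄₃ ⊠ ε̄₃⁻¹)` (which has `N(𝔽_q)`-fixed vectors),
strong approximation for `O'¹`. -/
def CartanCoverUnipotentFixedInSpan : Prop :=
  ∀ (D M : ℕ) (C : Finset ℕ) (X : CartanLevelCurveData D M C) (q : ℕ) [Fact q.Prime], q ∈ C → q % 3 = 1 →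
    ∀ (hO' : Brandt.IsOrder X.B (X.O ⊔ X.O₀.map ((((∏ p ∈ C.erase q, p : ℕ) : ℤ)) • LinearMap.id)))
      (S : Subring X.B) (_hS : ∀ x : X.B, x ∈ S ↔ x ∈ X.O ⊔ X.O₀.map ((((∏ p ∈ C.erase q, p : ℕ) : ℤ)) • LinearMap.id))
      (red : S →+* Matrix (Fin 2) (Fin 2) (ZMod q)),
      Function.Surjective red →
      (∀ x : S, red x = 0 ↔ ∃ y ∈ X.O ⊔ X.O₀.map ((((∏ p ∈ C.erase q, p : ℕ) : ℤ)) • LinearMap.id), (x : X.B) = (q : ℤ) • y) →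
      (∀ x : S, ∃ n : ℤ, reducedNorm ℚ X.B (x : X.B) = n ∧ (red x).det = (n : ZMod q)) →
    ∀ (V : WeierstrassCurve ℚ) [V.IsElliptic] [V.IsGloballyMinimal] (N : ℕ),
      V.conductorNorm ℤ = N → D * M * ∏ p ∈ C, p ^ 2 = N → ¬ q ^ 3 ∣ N →
      3 ∣ (V.baseChange ℚ_[q]).localTamagawaNumber ℤ_[q] →
    ∀ F₀ : CuspForm X.Gamma 2, (⇑F₀ : UpperHalfPlane → ℂ) ≠ 0 →
      (∀ ℓ : ℕ, ℓ.Prime → ¬ ℓ ∣ D * M * ∏ p ∈ C, p →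
        X.heckeFun ℓ F₀ = fun τ => ((V.LFunction ℓ : ℤ) : ℂ) * F₀ τ) →
      ∃ G ∈ Submodule.span ℂ (Set.range fun γ : normOneUnits X.ι hO' =>
          (⇑F₀ : UpperHalfPlane → ℂ) ∣[(2 : ℤ)] ((γ : GL (Fin 2) ℝ))),
        G ≠ 0 ∧ ∀ (γ : normOneUnits X.ι hO') (x : S), X.ι (x : X.B) = ((γ : GL (Fin 2) ℝ) : Matrix (Fin 2) (Fin 2) ℝ) →
          (red x) 0 0 = 1 → (red x) 1 0 = 0 → (red x) 1 1 = 1 →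
          G ∣[(2 : ℤ)] ((γ : GL (Fin 2) ℝ)) = G

/-! ## §2 (JV_Q) — verbatim copy of the registry's `Jacquet.JacquetVectorDocked` -/

/-- **(JV_Q) A JACQUET VECTOR IN THE DOCKED SPAN `ℂ[G]·u_C` at `q ≡ 1 (3)`** — VERBATIM copy (token for token) of the registry's `Jacquet.JacquetVectorDocked`
(`Cruxes/CartanOnePlaceDegreeLawAtThree/Lines/jacquet.lean` rev 11, 94a3f00c0fcfe0c7, l.1310–1319), typed here because the registry file is not importable from
`Theorems/`; the pen's rev 12 bridges `JacquetVectorDockedT ↔ Jacquet.JacquetVectorDocked` by `Iff.rfl`. Under NUM's binders at the Cartan place `q ≡ 1 (3)`: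
`ℂ[G]·dockNonsplit(Q.form)` contains a non-zero vector fixed by the unipotent radical `N = {n(y)}` of the upper-triangular Borel subgroup. A `def … : Prop`;
NOTHING ASSERTED. -/
def JacquetVectorDockedT : Prop :=
  ∀ (V : WeierstrassCurve ℚ) [V.IsElliptic] [V.IsGloballyMinimal], Surj V 3 →
    ∀ (N D M : ℕ) (C : Finset ℕ) (q : ℕ) [Fact q.Prime]
      (X : CartanLevelCurveData D M C) (W₁ : WeierstrassCurve ℚ) [W₁.IsElliptic] (Q : CartanParametrizationData X W₁)
      (hq : q ∈ C) (R : CoverReduction X q),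
      V.conductorNorm ℤ = N → D * M * ∏ p ∈ C, p ^ 2 = N → q ≠ 3 → ¬ q ^ 3 ∣ N →
      3 ∣ (V.baseChange ℚ_[q]).localTamagawaNumber ℤ_[q] → Q.IsMinimalFor V → q % 3 = 1 →
      ∃ x ∈ R.spanG (R.dockNonsplit hq Q.form), x ≠ 0 ∧ ∀ y : ZMod q, R.indRep (upperUnip y) x = x

/-! ## §3 PROVED: the glue (JVᴸ) ⟹ (JV_Q) -/

/-- **GLUE: (JVᴸ) ⟹ (JV_Q).** Instantiate (JVᴸ) at the cover order `coverOrder X q` (`isOrder_coverOrder`), its subring `coverSubring X q` (membership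
`Iff.rfl`), the reduction datum `red := R.red` (`R.red_surjective`, `R.red_eq_zero_iff`, `R.det_red`) and `F₀ := Q.form` (non-zero by
`CartanCover.MapDegree.cartan_form_ne_zero`; `a_ℓ(V)`-eigenform by `LFunction_eq_of_isIsogenous_holds` + `Q.hecke_eq`); a norm-one unit `γ` with
`redHom γ = n(y)` has lift `unitLift γ` (`ι_unitLift`) of residue `!![1, y; 0, 1]` (`coe_redHom`, `coe_upperUnip`), so the (JVᴸ) vector is `∣[2] γ`-fixed;
conclude by D-AVG `CoverReduction.exists_unipFixed_of_slashFixed` (`q ≠ 2` as `q ≡ 1 (3)`). CONDITIONAL on the explicit hypothesis (JVᴸ).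
[cite: Bump1997, Thm. 4.1.1 p. 406] [cite: KohenPacetti2016, §1.3 and §2 (arXiv:1403.7801v3 pp. 5–8)] -/
theorem jacquetVectorDocked_of_unipotentFixed (h : CartanCoverUnipotentFixedInSpan) : JacquetVectorDockedT := by
  intro V _ _ _ N D M C q _ X W₁ _ Q hq R hN hDMC _ hq3N hc hQ h1
  -- `Q.form` is a non-zero `a_ℓ(V)`-eigenform (as in `borelCubicEigenDocking_of_jacquet`)
  have hLV : V.LFunction = W₁.LFunction := LFunction_eq_of_isIsogenous_holds V W₁ hQ.1
  have hQe : ∀ ℓ : ℕ, ℓ.Prime → ¬ ℓ ∣ D * M * ∏ p ∈ C, p →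
      X.heckeFun ℓ Q.form = fun τ => ((V.LFunction ℓ : ℤ) : ℂ) * Q.form τ := by
    intro ℓ hℓ hnd
    rw [hLV]
    exact Q.hecke_eq ℓ hℓ hnd
  have hF0 : (⇑Q.form : UpperHalfPlane → ℂ) ≠ 0 := by
    intro h0
    apply CartanCover.MapDegree.cartan_form_ne_zero Q
    exact DFunLike.ext' (by rw [h0]; rfl)
  have hq2 : q ≠ 2 := by
    rintro rfl
    omega
  -- (JVᴸ) at the cover order, its subring and the reduction datum `R`, for `F₀ := Q.form`
  obtain ⟨G, hG, hG0, hGfix⟩ := h D M C X q hq h1 (isOrder_coverOrder X q) (coverSubring X q) (fun _ => Iff.rfl)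
    R.red R.red_surjective R.red_eq_zero_iff R.det_red V N hN hDMC hq3N hc Q.form hF0 hQe
  -- D-AVG: it remains to read `redHom γ = n(y)` as the three residue entries of the lift of `γ`
  refine R.exists_unipFixed_of_slashFixed hq hq2 Q.form hG hG0 fun γ y hγ => ?_
  have hred : R.red (unitLift γ) = !![1, y; 0, 1] := by
    rw [← R.coe_redHom γ, hγ, coe_upperUnip]
  exact hGfix γ (unitLift γ) (ι_unitLift γ) (by simp [hred]) (by simp [hred]) (by simp [hred])

end Summit.BirchSwinnertonDyer.BirchSwinnertonDyer.Theorems.CartanCover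

end
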